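import Summits.BirchSwinnertonDyer.Rank1Residual.Additive.QuadraticBranchLowerDescent
import Summits.BirchSwinnertonDyer.Rank1Residual.Additive.TypeGIntegralJ
import HarnessLib

/-!
# The ASCENT of dual data and the Λ-level EQUIVALENCE of the team's two typed LOWER inputs on the
# potentially good semistable-twist locus: the `W`-level `ChiBranchLowerDivisibility[Odd]At W p`
# (seat p07) and the `E♭`-level `QuadraticBranchLowerDivisibilityAt V p` over all twist models
# (seat p10) are ONE statement (cell `b2b-bsdres`, team n1011, seat p07 (gen 2), row T-N10-low
# NEXT (e); the converse of seat p10's `QuadraticBranchLowerDescent.lean`)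

HONEST FRAMING (cell `b2b-bsdres`, run/shared/lean/b2b/bsd-rank1-residual/, verbatim in every
file): the goal of the cell is to DELETE the COMBINATION-SHAPED residual classes of the
Birch–Swinnerton-Dyer formula for ALL analytic-rank `≤ 1` elliptic curves over `ℚ` — "full BSD
formula for every rank `≤ 1` curve in class `C`" assembled STRICTLY from published theorems — so
that the rank-`≤ 1` remainder becomes exactly the CONSTRUCTION-SHAPED classes, which are TYPED
(missing-input `Prop`s), NOT attempted. This is not "finishing BSD". Team n1011 (RESIDUAL-MAP §I
N10 / N11): prove what is provable now; shrink each hard class to its core with data; no claim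
beyond stated classes. Research route on the CONSTRUCTION-SHAPED item N10; it stays CONSTRUCTION;
nothing is booked; no label moves. Two bookkeeping DEFINITIONS (concrete maps — the inverse of
additive-p1/p2's eigen-descent of dual data; no predicate, no named fact) and theorems; neither
typed conjecture is asserted.

## What and why (anti-drift, "one notion, one def" at the Λ-level)

The team types the Skinner–Urban direction on the quadratic branch TWICE at the Iwasawa level:
seat p07's `W`-level `ChiBranchLowerDivisibilityAt W p` (`p ≡ 1 (mod 4)`; dual data of
`Sel_{p^∞}(W/ℚ_∞)`, good ordinary twist `V`, `ChiBranchLowerInput.lean`) / its odd twin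
`ChiBranchLowerDivisibilityOddAt W p` (`p ≡ 3 (mod 4)`, `ChiBranchLowerInputOdd.lean`), and seat
p10's `E♭`-level `QuadraticBranchLowerDivisibilityAt V p` (eigen-`Λ`-dual data of
`e_{(p−1)/2} Sel_{p^∞}(E♭/ℚ(μ_{p^∞}))`, any semistable `V`, `QuadraticBranchLower.lean`). Seat p10
proved `E♭`-level ⟹ `W`-level (`chiBranchLowerDivisibility[Odd]At_of_quadraticBranchLower`) by the
eigen-DESCENT of dual data (additive-p1's `SelmerDualData.toChiEigen`, additive-p2's `toIn`: same
module, same characteristic ideal). This file builds the eigen-ASCENT — the inverse transport along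
the same two isomorphisms `Θ : Sel_{p^∞}(W/ℚ_∞) ≃ Sel_{p^∞}(E♭/K·ℚ_∞)^{(χ_K)}`
(`twistDescentEquiv`) and `Sel^{(χ_K)}(K·ℚ_∞) ≃ Sel^{(χ_K)}(F·K·ℚ_∞)` (`chiEigenRestrictionEquiv`,
`p ∤ [Γ_ℚ : Gal(ℚ̄/F)]`) — and proves the converse, hence the EQUIVALENCE, on every POTENTIALLY GOOD
`W` (`0 ≤ ord_p j`, where no twist model is multiplicative, so the `E♭`-level conjecture's
multiplicative disjuncts are void and the `W`-level input — typed for a good ordinary twist — is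
the whole story):

* §1 `dualAscend`, `ChiEigenSelmerInDualData.toSelmerDualData` — an eigen-`Λ`-dual datum of
  `Sel_{p^∞}(E♭/F·K·ℚ_∞)^{(χ_K)}` at `γ ∈ Gal(ℚ̄/K)` IS a `Λ`-dual datum of `Sel_{p^∞}(W/ℚ_∞)` at
  `γ` with the SAME module (`toSelmerDualData_X`, `charIdeal_toSelmerDualData`: `rfl`).
* §2 `not_mem_range_algebraMap_of_sq_eq_pStar` — `θ² = p*` forces `θ ∉ ℚ` (a prime is not a
  rational square).
* §3 `quadraticBranchLowerDivisibilityAt_of_chiBranchLowerDivisibility` (`p ≡ 1 (mod 4)`) and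
  `…_of_chiBranchLowerDivisibilityOdd` (`p ≡ 3 (mod 4)`, `p = 3` included): on a potentially good
  `W`, the `W`-level input ⟹ the `E♭`-level conjecture for EVERY twist model `V` of `W`; with seat
  p10's descent, the iffs `chiBranchLowerDivisibilityAt_iff_forall_quadraticBranchLower`,
  `chiBranchLowerDivisibilityOddAt_iff_forall_quadraticBranchLower`, and the parity-free
  `forall_quadraticBranchLower_iff_chiBranchLowerDivisibility_and_odd` (every odd `p`: the `∀`-twist
  form ⟺ even ∧ odd `W`-level inputs, the off-parity one being vacuous); class form on the
  (G)-ordinary rows (`TypeGOrd W p ⟹ 0 ≤ ord_p j`):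
  `TypeGOrd.forall_quadraticBranchLower_iff_chiBranchLowerDivisibility_and_odd`.

So on X4♯(G-ord) ∩ `I₀*` / X3♯(G-ord) ∩ `I₀*` the hypothesis of every `…_of_quadraticBranchLower…`
class theorem (`X4RankZeroQuadraticBranchLower[Gord].lean`, p12's `X3BranchLowerDescent.lean`) and
of seat p01's rank-one factorisation (`cycLowerBoundAt_of_chiBranchLower_of_branchPAdicGrossZagier`,
which takes the `W`-level input) is literally the same missing input. The (M) rows are not touched
(`W`-level Λ-adic inputs are typed for a good ordinary twist only; there the `E♭`-level conjecture is
the decl of record). Labels UNCHANGED; nothing booked.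

References: Greenberg 1999 [GreenbergLNM1716] §5 (PDF p. 143) (prime-to-`p` descent of Selmer
groups); Mazur 1972 [Mazur1972] §6 (the `Λ`-dual); Skinner–Urban 2014 [SkinnerUrban2014] Thm. 3.6.4
(shape only; nothing asserted).
-/

noncomputable section

open scoped Classical MatrixGroups ModularForm

open CongruenceSubgroup WeierstrassCurve Literature.NumberTheory.EllipticCurves
  Literature.NumberTheory.EllipticCurves.ModularForms
  Literature.NumberTheory.EllipticCurves.Rank1Residual
  Literature.NumberTheory.GaloisRepresentations

namespace Summit.BirchSwinnertonDyer.Rank1Residual.Additive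

open AdditivePotMult

/-! ### §1 The ascent of dual data (inverse of `SelmerDualData.toChiEigenIn`), same module -/

section Ascent

variable (V : WeierstrassCurve ℚ) (K : Type) [Field K] [NumberField K]
  (h2 : Module.finrank ℚ K = 2) {θ : K} {c : ℚ} (hθ : θ ∉ Set.range (algebraMap ℚ K))
  (hc : θ ^ 2 = algebraMap ℚ K c) (p : ℕ) [Fact p.Prime] (κ : ZpExtension ℚ p)
  [(galRange (K := ℚ) K).Normal] [(V.quadraticTwist c).IsElliptic] [V.IsElliptic]
  {W : WeierstrassCurve ℚ} {C : VariableChange ℚ} (hCW : C • V.quadraticTwist c = W)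
  (U : Subgroup (Field.absoluteGaloisGroup ℚ)) [U.Normal]
  (hU : IsOpen (U : Set (Field.absoluteGaloisGroup ℚ))) (hcop : U.index.Coprime p) (hp2 : p ≠ 2)

/-- Precomposition with the FORWARD eigen-descent `Θ_U ∘ Θ : Sel_{p^∞}(W/ℚ_∞) → Sel^{(χ_K)}(F·K·ℚ_∞)`
on character groups (the inverse of additive-p1/p2's `dualTransport` / `dualDescend`). [folklore] -/
def dualAscend :
    (chiEigenSelmerIn V K p κ U →+ AddCircle (1 : ℚ)) →+ (W.selmerInfty κ →+ AddCircle (1 : ℚ)) :=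
  AddMonoidHom.compHom'
    ((chiEigenRestrictionEquiv V K p κ U hU hcop).toAddMonoidHom.comp
      (twistDescentEquiv V K h2 hθ hc p κ hCW hp2).toAddMonoidHom)

/-- Values of `dualAscend`. [folklore] -/
theorem dualAscend_apply (x : chiEigenSelmerIn V K p κ U →+ AddCircle (1 : ℚ)) (s : W.selmerInfty κ) :
    dualAscend V K h2 hθ hc p κ hCW U hU hcop hp2 x s =
      x (chiEigenRestrictionEquiv V K p κ U hU hcop (twistDescentEquiv V K h2 hθ hc p κ hCW hp2 s)) :=
  rfl

/-- `dualAscend` is bijective (precomposition with an isomorphism). [folklore] -/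
theorem dualAscend_bijective : Function.Bijective (dualAscend V K h2 hθ hc p κ hCW U hU hcop hp2) := by
  set Θ := twistDescentEquiv V K h2 hθ hc p κ hCW hp2
  set ΘU := chiEigenRestrictionEquiv V K p κ U hU hcop
  refine ⟨fun x y hxy ↦ ?_, fun z ↦ ⟨z.comp (Θ.symm.toAddMonoidHom.comp ΘU.symm.toAddMonoidHom), ?_⟩⟩
  · ext t
    have h := DFunLike.congr_fun hxy (Θ.symm (ΘU.symm t))
    rw [dualAscend_apply, dualAscend_apply] at h
    change x (ΘU (Θ (Θ.symm (ΘU.symm t)))) = y (ΘU (Θ (Θ.symm (ΘU.symm t)))) at h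
    rwa [AddEquiv.apply_symm_apply, AddEquiv.apply_symm_apply] at h
  · ext s
    rw [dualAscend_apply, AddMonoidHom.comp_apply, AddMonoidHom.comp_apply]
    change z (Θ.symm (ΘU.symm (ΘU (Θ s)))) = z s
    rw [AddEquiv.symm_apply_apply, AddEquiv.symm_apply_apply]

/-- **The eigen-ASCENT of dual data (inverse of additive-p2's `SelmerDualData.toChiEigenIn`).** For
`E = E♭ ⊗ χ_K` (`C • V^{(c)} = W`, `K = ℚ(θ)`, `θ² = c`), `p` odd, `U` open normal with
`p ∤ [Γ_ℚ : U]` (`F = ℚ̄^U`) and `γ ∈ Gal(ℚ̄/K)`: every eigen-`Λ`-dual datum `D` of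
`Sel_{p^∞}(E♭/F·K·ℚ_∞)^{(χ_K)}` at `γ` IS a `Λ`-dual datum of `Sel_{p^∞}(E/ℚ_∞)` at `γ` with the
SAME module `D.X`: the character group is moved along `Θ_U ∘ Θ` (`dualAscend`); `T ↔ γ_* − 1` is
preserved because `Θ` is `γ`-equivariant for `γ ∈ Gal(ℚ̄/K)` (`coe_twistDescentEquiv_conjH1`,
`quadSign K γ = 1`) and the restriction commutes with `γ_*` (`coe_chiEigenRestrictionEquiv_conjH1`);
the `ℤ_p`-action clause because group isomorphisms preserve `p^k`-torsion.
[cite: GreenbergLNM1716, §5 (PDF p. 143)] [cite: Mazur1972, §6] -/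
def ChiEigenSelmerInDualData.toSelmerDualData {γ : Field.absoluteGaloisGroup ℚ}
    (hγ : γ ∈ galRange (K := ℚ) K) (D : ChiEigenSelmerInDualData V K κ U γ) : W.SelmerDualData κ γ where
  X := D.X
  conj_mem := fun s hs ↦ W.map_conjH1_selmerGroupOver_le_holds p κ.kerSubgroup γ ⟨s, hs, rfl⟩
  toDual := (dualAscend V K h2 hθ hc p κ hCW U hU hcop hp2).comp D.toDual
  bijective := (dualAscend_bijective V K h2 hθ hc p κ hCW U hU hcop hp2).comp D.bijective
  toDual_T_smul := fun x s ↦ by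
    set Θ := twistDescentEquiv V K h2 hθ hc p κ hCW hp2 with hΘ
    set ΘU := chiEigenRestrictionEquiv V K p κ U hU hcop with hΘU
    -- `γ_* s` as a Selmer class
    let s' : W.selmerInfty κ := ⟨W.conjH1 p κ.kerSubgroup γ (s : W.subgroupH1 p κ.kerSubgroup),
      W.map_conjH1_selmerGroupOver_le_holds p κ.kerSubgroup γ ⟨s, s.2, rfl⟩⟩
    -- `Θ (γ_* s) = γ_* (Θ s)` (`γ ∈ Gal(ℚ̄/K)`), then `Θ_U (γ_* t) = γ_* (Θ_U t)`
    have h1 : Θ s' = ⟨V.conjH1 p _ γ (Θ s), conjH1_mem_chiEigenSelmer V K κ γ (Θ s).2⟩ := by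
      apply Subtype.ext
      rw [hΘ, coe_twistDescentEquiv_conjH1 V K h2 hθ hc p κ hCW hp2 γ s s' rfl, quadSign_of_mem K hγ,
        one_smul]
    have h2' : ΘU (Θ s') = ⟨V.conjH1 p _ γ (ΘU (Θ s)), conjH1_mem_chiEigenSelmerIn γ (ΘU (Θ s)).2⟩ := by
      apply Subtype.ext
      rw [h1, hΘU, coe_chiEigenRestrictionEquiv_conjH1]
    show D.toDual ((PowerSeries.X : IwasawaAlgebra p) • x) (ΘU (Θ s)) =
      D.toDual x (ΘU (Θ s')) - D.toDual x (ΘU (Θ s))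
    rw [D.toDual_T_smul, h2']
  toDual_C_smul := fun c' x s k hk ↦ by
    show D.toDual (PowerSeries.C c' • x)
        (chiEigenRestrictionEquiv V K p κ U hU hcop (twistDescentEquiv V K h2 hθ hc p κ hCW hp2 s)) =
      (PadicInt.toZModPow k c').val •
        D.toDual x (chiEigenRestrictionEquiv V K p κ U hU hcop (twistDescentEquiv V K h2 hθ hc p κ hCW hp2 s))
    exact D.toDual_C_smul c' x _ k (by rw [← map_nsmul, ← map_nsmul, hk, map_zero, map_zero])

/-- The ascended datum has the same underlying module. [folklore] -/
theorem ChiEigenSelmerInDualData.toSelmerDualData_X {γ : Field.absoluteGaloisGroup ℚ}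
    (hγ : γ ∈ galRange (K := ℚ) K) (D : ChiEigenSelmerInDualData V K κ U γ) :
    (ChiEigenSelmerInDualData.toSelmerDualData V K h2 hθ hc p κ hCW U hU hcop hp2 hγ D).X = D.X :=
  rfl

/-- **Same characteristic ideal**: a divisibility in `char_Λ X(E/ℚ_∞)` of the ascended datum is a
divisibility in `char_Λ` of the eigen datum. [folklore] -/
theorem ChiEigenSelmerInDualData.charIdeal_toSelmerDualData {γ : Field.absoluteGaloisGroup ℚ}
    (hγ : γ ∈ galRange (K := ℚ) K) (D : ChiEigenSelmerInDualData V K κ U γ) :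
    (ChiEigenSelmerInDualData.toSelmerDualData V K h2 hθ hc p κ hCW U hU hcop hp2 hγ D).charIdeal =
      Literature.NumberTheory.EllipticCurves.Module.charIdeal (IwasawaAlgebra p) D.X :=
  rfl

/-- Same torsion-ness. [folklore] -/
theorem ChiEigenSelmerInDualData.isTorsion_toSelmerDualData_iff {γ : Field.absoluteGaloisGroup ℚ}
    (hγ : γ ∈ galRange (K := ℚ) K) (D : ChiEigenSelmerInDualData V K κ U γ) :
    (ChiEigenSelmerInDualData.toSelmerDualData V K h2 hθ hc p κ hCW U hU hcop hp2 hγ D).IsTorsion ↔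
      Module.IsTorsion (IwasawaAlgebra p) D.X :=
  Iff.rfl

end Ascent

/-! ### §2 `θ² = p*` forces `θ ∉ ℚ` -/

/-- If `θ² = p*` in a field of characteristic `0`, `p* = (−1)^{⌊p/2⌋} p` for a prime `p`, then
`θ` is not rational: `−p < 0` is not a rational square and neither is the prime `p`
(`Prime.not_isSquare`, `Rat.isSquare_natCast_iff`). [folklore] -/
theorem not_mem_range_algebraMap_of_sq_eq_pStar {K : Type} [Field K] [CharZero K] {p : ℕ}
    [hp : Fact p.Prime] {θ : K} (hθ : θ ^ 2 = algebraMap ℚ K ((-1) ^ (p / 2) * p)) :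
    θ ∉ Set.range (algebraMap ℚ K) := by
  rintro ⟨q, rfl⟩
  rw [← map_pow] at hθ
  have hq : q ^ 2 = (-1) ^ (p / 2) * p := (algebraMap ℚ K).injective hθ
  have hp0 : (0 : ℚ) < p := by exact_mod_cast hp.out.pos
  rcases neg_one_pow_eq_or ℚ (p / 2) with h1 | h1 <;> rw [h1] at hq
  · -- `q² = p`: a prime is not a square
    have hsq : IsSquare (p : ℚ) := ⟨q, by rw [← sq, hq, one_mul]⟩
    exact hp.out.prime.not_isSquare (Rat.isSquare_natCast_iff.mp hsq)
  · -- `q² = −p < 0`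
    nlinarith [sq_nonneg q]

/-! ### §3 The `W`-level Λ-adic input ⟹ the `E♭`-level conjecture on a potentially good `W`; the iffs -/

section Equivalence

variable {W : WeierstrassCurve ℚ} [W.IsElliptic] {p : ℕ} [hp : Fact p.Prime]

/-- **Ascent, EVEN branch (`p ≡ 1 (mod 4)`): on a potentially good `W` (`0 ≤ ord_p j(W)`), seat
p07's `W`-level input `ChiBranchLowerDivisibilityAt W p` implies seat p10's `E♭`-level conjecture
`QuadraticBranchLowerDivisibilityAt V p` for EVERY globally minimal twist model `V` (`C • V^{(p)} = W`).**
Given the conjecture's binders `(K, F, κ, γ, f, B, D, ϖ)`: `V` is not multiplicative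
(`not_mult_of_model_twist_of_padicValRat_j_nonneg`), so the reduction disjunction reads
`IsOrdinaryAt V p ∧ B = L_p(f, α, ω^{(p−1)/2}, T)`; `θ ∉ ℚ` (§2); the eigen datum `D` ascends to a
dual datum of `Sel_{p^∞}(W/ℚ_∞)` at the same `γ` with the same characteristic ideal (§1,
`U = Gal(ℚ̄/F)`, index `p − 1`); the `W`-level input at that datum is the claim. The converse is
seat p10's `chiBranchLowerDivisibilityAt_of_quadraticBranchLower`. [cite: GreenbergLNM1716, §5 (PDF p. 143)]
[cite: SkinnerUrban2014, Thm. 3.6.4 (p. 43) (shape only; nothing asserted)] -/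
theorem quadraticBranchLowerDivisibilityAt_of_chiBranchLowerDivisibility (hp1 : p % 4 = 1)
    (hj : 0 ≤ padicValRat p W.j) (hL : ChiBranchLowerDivisibilityAt W p)
    (V : WeierstrassCurve ℚ) [V.IsElliptic] [V.IsGloballyMinimal]
    (hVW : ∃ C : VariableChange ℚ, C • V.quadraticTwist ((-1) ^ (p / 2) * p : ℚ) = W) :
    QuadraticBranchLowerDivisibilityAt V p := by
  intro K _ _ _ F _ _ _ _ κ γ N _ f B hp2 hK2 hθ hB hκ hγ hcv hγK hγF hf D ϖ hϖ g hg
  have heven : Even (p / 2) := ⟨p / 4, by omega⟩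
  have hpS : ((-1 : ℚ) ^ (p / 2) * p) ≠ 0 :=
    mul_ne_zero (pow_ne_zero _ (by norm_num)) (Nat.cast_ne_zero.mpr hp.out.ne_zero)
  obtain ⟨C, hC⟩ := hVW
  -- `V` is good ordinary: the multiplicative disjuncts are void on a potentially good `W`
  have hnm : ¬ Mult V p := not_mult_of_model_twist_of_padicValRat_j_nonneg W V hpS ⟨C, hC⟩ hj
  obtain ⟨hord, hBeq⟩ : IsOrdinaryAt V p ∧
      B = padicLFunctionBranch f ((unitRoot V p : ℤ_[p]) : ℚ_[p]) (p / 2) := by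
    rcases hB with ⟨hord, hB⟩ | ⟨hs, -⟩ | ⟨hm, -, -⟩
    · exact ⟨hord, by rw [hB, if_pos heven]⟩
    · exact absurd hs.hasMultiplicativeReductionAtPrime hnm
    · exact absurd hm hnm
  rw [if_pos heven] at hϖ
  -- the ascent datum at `γ`
  obtain ⟨θ, hθ2⟩ := hθ
  have hθnr : θ ∉ Set.range (algebraMap ℚ K) := not_mem_range_algebraMap_of_sq_eq_pStar hθ2
  haveI : (V.quadraticTwist ((-1 : ℚ) ^ (p / 2) * p)).IsElliptic := V.isElliptic_quadraticTwist hpS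
  let D' : W.SelmerDualData κ γ :=
    ChiEigenSelmerInDualData.toSelmerDualData V K hK2 hθnr hθ2 p κ hC (galRange (K := ℚ) F)
      (isOpen_galRange F) (coprime_index_galRange_cyclotomic p F) hp2 hγK D
  have hg' : g ∈ D'.charIdeal := hg
  have hCp : ∃ C : VariableChange ℚ, C • V.quadraticTwist (p : ℚ) = W :=
    ⟨C, by rw [pStar_eq_self_of_mod_four_eq_one hp1] at hC; exact hC⟩
  obtain ⟨h, hιg⟩ := hL V hp1 hCp hord hκ hγ hcv hf D' ϖ hϖ g hg'
  exact ⟨h, by rw [hBeq]; exact hιg⟩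

/-- **Ascent, ODD branch (`p ≡ 3 (mod 4)`, `p = 3` included)**: on a potentially good `W`,
`ChiBranchLowerDivisibilityOddAt W p` implies `QuadraticBranchLowerDivisibilityAt V p` for every
globally minimal twist model `V` (`C • V^{(−p)} = W`; minus branch, minus period). Converse: seat
p10's `chiBranchLowerDivisibilityOddAt_of_quadraticBranchLower`. [cite: GreenbergLNM1716, §5 (PDF p. 143)]
[cite: SkinnerUrban2014, Thm. 3.6.4 (p. 43) (shape only; nothing asserted)] -/
theorem quadraticBranchLowerDivisibilityAt_of_chiBranchLowerDivisibilityOdd (hp3 : p % 4 = 3)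
    (hj : 0 ≤ padicValRat p W.j) (hL : ChiBranchLowerDivisibilityOddAt W p)
    (V : WeierstrassCurve ℚ) [V.IsElliptic] [V.IsGloballyMinimal]
    (hVW : ∃ C : VariableChange ℚ, C • V.quadraticTwist ((-1) ^ (p / 2) * p : ℚ) = W) :
    QuadraticBranchLowerDivisibilityAt V p := by
  intro K _ _ _ F _ _ _ _ κ γ N _ f B hp2 hK2 hθ hB hκ hγ hcv hγK hγF hf D ϖ hϖ g hg
  have hodd : ¬ Even (p / 2) := by rw [Nat.not_even_iff_odd]; exact ⟨p / 4, by omega⟩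
  have hpS : ((-1 : ℚ) ^ (p / 2) * p) ≠ 0 :=
    mul_ne_zero (pow_ne_zero _ (by norm_num)) (Nat.cast_ne_zero.mpr hp.out.ne_zero)
  obtain ⟨C, hC⟩ := hVW
  have hnm : ¬ Mult V p := not_mult_of_model_twist_of_padicValRat_j_nonneg W V hpS ⟨C, hC⟩ hj
  obtain ⟨hord, hBeq⟩ : IsOrdinaryAt V p ∧
      B = padicLFunctionMinusBranch f ((unitRoot V p : ℤ_[p]) : ℚ_[p]) (p / 2) := by
    rcases hB with ⟨hord, hB⟩ | ⟨hs, -⟩ | ⟨hm, -, -⟩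
    · exact ⟨hord, by rw [hB, if_neg hodd]⟩
    · exact absurd hs.hasMultiplicativeReductionAtPrime hnm
    · exact absurd hm hnm
  rw [if_neg hodd] at hϖ
  obtain ⟨θ, hθ2⟩ := hθ
  have hθnr : θ ∉ Set.range (algebraMap ℚ K) := not_mem_range_algebraMap_of_sq_eq_pStar hθ2
  haveI : (V.quadraticTwist ((-1 : ℚ) ^ (p / 2) * p)).IsElliptic := V.isElliptic_quadraticTwist hpS
  let D' : W.SelmerDualData κ γ :=
    ChiEigenSelmerInDualData.toSelmerDualData V K hK2 hθnr hθ2 p κ hC (galRange (K := ℚ) F)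
      (isOpen_galRange F) (coprime_index_galRange_cyclotomic p F) hp2 hγK D
  have hg' : g ∈ D'.charIdeal := hg
  have hCp : ∃ C : VariableChange ℚ, C • V.quadraticTwist (-(p : ℚ)) = W :=
    ⟨C, by rw [pStar_eq_neg_of_mod_four_eq_three hp3] at hC; exact hC⟩
  obtain ⟨h, hιg⟩ := hL V hp3 hCp hord hκ hγ hcv hf D' ϖ hϖ g hg'
  exact ⟨h, by rw [hBeq]; exact hιg⟩

end Equivalence

section Iff

variable (W : WeierstrassCurve ℚ) [W.IsElliptic] (p : ℕ) [hp : Fact p.Prime]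

/-- **Λ-level EQUIVALENCE, even branch (`p ≡ 1 (mod 4)`), potentially good `W`:**
`ChiBranchLowerDivisibilityAt W p ↔ ∀ twist models V of W, QuadraticBranchLowerDivisibilityAt V p`
(⟸ is seat p10's descent). The two typed LOWER inputs are ONE statement.
[cite: GreenbergLNM1716, §5 (PDF p. 143)] [cite: SkinnerUrban2014, Thm. 3.6.4 (p. 43) (shape only; nothing asserted)] -/
theorem chiBranchLowerDivisibilityAt_iff_forall_quadraticBranchLower (hp1 : p % 4 = 1)
    (hj : 0 ≤ padicValRat p W.j) :
    ChiBranchLowerDivisibilityAt W p ↔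
      ∀ (V : WeierstrassCurve ℚ) [V.IsElliptic] [V.IsGloballyMinimal],
        (∃ C : VariableChange ℚ, C • V.quadraticTwist ((-1) ^ (p / 2) * p : ℚ) = W) →
          QuadraticBranchLowerDivisibilityAt V p :=
  ⟨fun hL V _ _ hVW ↦
      quadraticBranchLowerDivisibilityAt_of_chiBranchLowerDivisibility hp1 hj hL V hVW,
    chiBranchLowerDivisibilityAt_of_quadraticBranchLower W p⟩

/-- **Λ-level EQUIVALENCE, odd branch (`p ≡ 3 (mod 4)`, `p = 3` included), potentially good `W`:**
`ChiBranchLowerDivisibilityOddAt W p ↔ ∀ twist models V of W, QuadraticBranchLowerDivisibilityAt V p`.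
[cite: GreenbergLNM1716, §5 (PDF p. 143)] [cite: SkinnerUrban2014, Thm. 3.6.4 (p. 43) (shape only; nothing asserted)] -/
theorem chiBranchLowerDivisibilityOddAt_iff_forall_quadraticBranchLower (hp3 : p % 4 = 3)
    (hj : 0 ≤ padicValRat p W.j) :
    ChiBranchLowerDivisibilityOddAt W p ↔
      ∀ (V : WeierstrassCurve ℚ) [V.IsElliptic] [V.IsGloballyMinimal],
        (∃ C : VariableChange ℚ, C • V.quadraticTwist ((-1) ^ (p / 2) * p : ℚ) = W) →
          QuadraticBranchLowerDivisibilityAt V p :=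
  ⟨fun hL V _ _ hVW ↦
      quadraticBranchLowerDivisibilityAt_of_chiBranchLowerDivisibilityOdd hp3 hj hL V hVW,
    chiBranchLowerDivisibilityOddAt_of_quadraticBranchLower W p⟩

/-- **Parity-free Λ-level EQUIVALENCE, every odd `p`, potentially good `W`:** the `∀`-twist-model
form of seat p10's conjecture ⟺ (even `W`-level input ∧ odd `W`-level input) — the input of the
wrong parity holds vacuously (its `p % 4` premise fails). [cite: GreenbergLNM1716, §5 (PDF p. 143)]
[cite: SkinnerUrban2014, Thm. 3.6.4 (p. 43) (shape only; nothing asserted)] -/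
theorem forall_quadraticBranchLower_iff_chiBranchLowerDivisibility_and_odd (hp2 : p ≠ 2)
    (hj : 0 ≤ padicValRat p W.j) :
    (∀ (V : WeierstrassCurve ℚ) [V.IsElliptic] [V.IsGloballyMinimal],
        (∃ C : VariableChange ℚ, C • V.quadraticTwist ((-1) ^ (p / 2) * p : ℚ) = W) →
          QuadraticBranchLowerDivisibilityAt V p) ↔
      ChiBranchLowerDivisibilityAt W p ∧ ChiBranchLowerDivisibilityOddAt W p := by
  refine ⟨fun hc ↦ ⟨chiBranchLowerDivisibilityAt_of_quadraticBranchLower W p hc,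
    chiBranchLowerDivisibilityOddAt_of_quadraticBranchLower W p hc⟩, fun ⟨hE, hO⟩ V _ _ hVW ↦ ?_⟩
  obtain ⟨k, hk⟩ : Odd p := hp.out.odd_of_ne_two hp2
  rcases (show p % 4 = 1 ∨ p % 4 = 3 by omega) with hp4 | hp4
  · exact quadraticBranchLowerDivisibilityAt_of_chiBranchLowerDivisibility hp4 hj hE V hVW
  · exact quadraticBranchLowerDivisibilityAt_of_chiBranchLowerDivisibilityOdd hp4 hj hO V hVW

/-- **Class form on the (G)-ordinary rows** (`TypeGOrd W p ⟹ 0 ≤ ord_p j(W)`,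
`padicValRat_j_nonneg_of_typeGOrd`): on X3♯(G-ord) / X4♯(G-ord) at every odd `p` the `∀`-twist-model
form of seat p10's conjecture and the pair of `W`-level inputs are ONE statement.
[cite: GreenbergLNM1716, §5 (PDF p. 143)] [cite: SkinnerUrban2014, Thm. 3.6.4 (p. 43) (shape only; nothing asserted)] -/
theorem TypeGOrd.forall_quadraticBranchLower_iff_chiBranchLowerDivisibility_and_odd (hp2 : p ≠ 2)
    (hG : TypeGOrd W p) :
    (∀ (V : WeierstrassCurve ℚ) [V.IsElliptic] [V.IsGloballyMinimal],
        (∃ C : VariableChange ℚ, C • V.quadraticTwist ((-1) ^ (p / 2) * p : ℚ) = W) →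
          QuadraticBranchLowerDivisibilityAt V p) ↔
      ChiBranchLowerDivisibilityAt W p ∧ ChiBranchLowerDivisibilityOddAt W p :=
  -- (root-qualified: inside `TypeGOrd.…` the short name would resolve to this very declaration)
  Summit.BirchSwinnertonDyer.Rank1Residual.Additive.forall_quadraticBranchLower_iff_chiBranchLowerDivisibility_and_odd
    W p hp2 (padicValRat_j_nonneg_of_typeGOrd W p hG)

end Iff

end Summit.BirchSwinnertonDyer.Rank1Residual.Additive

end
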